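import Summits.ResolutionOfSingularities.ResolutionOfSingularities.Theorems.EquisingularLiftEquisingularLiftOrdinaryPointsHomogenization
import Mathlib.RingTheory.MvPolynomial.Ideal
import Mathlib.Algebra.Ring.GeomSum
import HarnessLib

/-!
# [OURS · tools] THE VERTEX CHART OF `σ*P` FOR A SUBSTITUTION `σ` FIXING THE VERTEX: initial form `λ^{e−μ}·Φ(M y)`, remainder in `(y)^{μ+1}`
# (toward the intrinsic «ordinary multiple points in general position» theorem of cruxes `EquisingularLiftNat(Three)` / `EquisingularLift`)

[OURS · leafhand-res-equisingularlift-7 g1, 2026-08-31; cell `pub/decomp-res`] AI-produced, weaker than expert review; NOT a statement of any manuscript.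
DEF-FREE helper; no `sorry`; standard axioms.

Let `P` be a form of degree `e` with vertex chart `P(x_c := 1) = Φ + Ψ` (`Φ` a form of degree `μ ≤ e`, `Ψ ∈ (y)^{μ+1}`: the (ord) datum of T-MULTIORD at the
vertex `e_c`), and `σ` ANY substitution by polynomials whose charts `ρ_i := σ_i(x_c := 1)` have no constant term for `i ≠ c` (e.g. a LINEAR substitution
fixing the point `[e_c]`).  Then the vertex chart of `σ*P = P(σ₀, …, σ_N)` is

  `(σ*P)(x_c := 1) = λ^{e−μ} · Φ(M) + Ψ'`,  `Ψ' ∈ (y)^{μ+1}`,  `λ = ρ_c(0)`,  `M_j = ρ_{c.succAbove j}`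

(`dehomogenize_aeval_eq_initial_add`): the multiplicity `μ` and — up to the linear substitution `M` and the scalar `λ^{e−μ}` — the tangent cone `Φ` of
`V₊(P)` at `e_c` do not depend on the coordinates.  Ingredients: ✓ `eq_sum_X_pow_mul_rename_homogeneousComponent` (explicit homogenisation, p824570),
`dehomogenize_aeval_eq_sum` (the expansion `Σₘ ρ_c^{e−m} · Qₘ(M)`), homogeneous components of `Φ + Ψ` (Mathlib `mem_pow_idealOfVars_iff`),
`aeval_mem_pow_of_forall_mem` (`M*` preserves `(y)^k`), `(C λ + w)^j − C λ^j ∈ (w)` (Mathlib `sub_dvd_pow_sub_pow`).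

What remains for the intrinsic multi-point theorem (census): (i) `IsNonsingularForm (aeval M Φ)` for INVERTIBLE linear `M` (closed-point criterion + chain
rule), (ii) the matrix bookkeeping producing `σ = shear⁻¹ ∘ τ'` with `M` invertible from `τ' ∈ GL`.

References: [Hartshorne1977, I §2 (proof of Prop. 2.2), I Ex. 5.8]; [Matsumura1987, §14 (multiplicity, tangent cone)].
-/

set_option linter.dupNamespace false -- mandated namespace `Summit.<Summit>.<Problem>` of this single-conjunct summit

noncomputable section

open MvPolynomial
open Literature.AlgebraicGeometry.Motives Literature.AlgebraicGeometry.Motives.ProjectiveSpace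

namespace Summit.ResolutionOfSingularities.ResolutionOfSingularities.Cruxes.EquisingularLiftNat.Sections

namespace MultiOrd

variable {K : Type} [Field K] {N : ℕ} (c : Fin (N + 1))

/-! ## The chart of a substituted form -/

/-- `(σ*P)(x_c := 1) = P(ρ₀, …, ρ_N)` with `ρ_i = σ_i(x_c := 1)`. [folklore] -/
theorem dehomogenize_aeval (σ : Fin (N + 1) → MvPolynomial (Fin (N + 1)) K) (P : MvPolynomial (Fin (N + 1)) K) :
    ProjectiveSpace.dehomogenize K c (aeval σ P) = aeval (fun i => ProjectiveSpace.dehomogenize K c (σ i)) P := by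
  rw [ProjectiveSpace.dehomogenize, ← AlgHom.comp_apply, MvPolynomial.comp_aeval]

/-- **The expansion of the chart of `σ*P` along the homogeneous components of the chart of `P`**:
`(σ*P)(x_c := 1) = Σ_{m ≤ e} ρ_c^{e−m} · Qₘ(ρ_{c.succAbove ·})`, `Q = P(x_c := 1)`. [cite: Hartshorne1977, I §2, proof of Prop. 2.2] -/
theorem dehomogenize_aeval_eq_sum {e : ℕ} {P : MvPolynomial (Fin (N + 1)) K} (hP : P.IsHomogeneous e)
    (σ : Fin (N + 1) → MvPolynomial (Fin (N + 1)) K) :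
    ProjectiveSpace.dehomogenize K c (aeval σ P) = ∑ m ∈ Finset.range (e + 1),
      ProjectiveSpace.dehomogenize K c (σ c) ^ (e - m) *
        aeval (fun j => ProjectiveSpace.dehomogenize K c (σ (c.succAbove j))) (homogeneousComponent m (ProjectiveSpace.dehomogenize K c P)) := by
  rw [dehomogenize_aeval]
  conv_lhs => rw [eq_sum_X_pow_mul_rename_homogeneousComponent c hP]
  rw [map_sum]
  refine Finset.sum_congr rfl fun m _ => ?_
  rw [map_mul, map_pow, aeval_X, aeval_rename]
  rfl

/-! ## Homogeneous components of an (ord) datum `Φ + Ψ` -/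

/-- A member of `(y)^k` has no homogeneous component of degree `< k`. [folklore] -/
theorem homogeneousComponent_eq_zero_of_mem_pow {M : ℕ} {Ψ : MvPolynomial (Fin M) K} {k m : ℕ}
    (hΨ : Ψ ∈ Ideal.span (Set.range (X : Fin M → MvPolynomial (Fin M) K)) ^ k) (hm : m < k) :
    homogeneousComponent m Ψ = 0 := by
  refine homogeneousComponent_eq_zero' m Ψ fun d hd => ?_
  have h := (MvPolynomial.mem_pow_idealOfVars_iff k Ψ).mp hΨ d hd
  omega

/-- The components of `Φ + Ψ` (`Φ` a form of degree `μ`, `Ψ ∈ (y)^{μ+1}`): `Q_μ = Φ` and `Q_m = 0` for `m < μ`. [folklore] -/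
theorem homogeneousComponent_add_of_mem_pow {M : ℕ} {Φ Ψ : MvPolynomial (Fin M) K} {μ : ℕ} (hΦ : Φ.IsHomogeneous μ)
    (hΨ : Ψ ∈ Ideal.span (Set.range (X : Fin M → MvPolynomial (Fin M) K)) ^ (μ + 1)) :
    homogeneousComponent μ (Φ + Ψ) = Φ ∧ ∀ m, m < μ → homogeneousComponent m (Φ + Ψ) = 0 := by
  refine ⟨?_, fun m hm => ?_⟩
  · rw [map_add, homogeneousComponent_eq_self hΦ, homogeneousComponent_eq_zero_of_mem_pow hΨ (Nat.lt_succ_self μ), add_zero]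
  · rw [map_add, homogeneousComponent_of_mem hΦ, if_neg (Nat.ne_of_lt hm),
      homogeneousComponent_eq_zero_of_mem_pow hΨ (Nat.lt_succ_of_lt hm), add_zero]

/-- A form of degree `m` lies in `(y)^m`. [folklore] -/
theorem mem_pow_of_isHomogeneous {M : ℕ} {Q : MvPolynomial (Fin M) K} {m : ℕ} (hQ : Q.IsHomogeneous m) :
    Q ∈ Ideal.span (Set.range (X : Fin M → MvPolynomial (Fin M) K)) ^ m := by
  refine (MvPolynomial.mem_pow_idealOfVars_iff m Q).mpr fun d hd => ?_
  have h := hQ (mem_support_iff.mp hd)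
  rw [Finsupp.degree_eq_weight_one]
  exact h.symm.le

/-- A polynomial with zero constant coefficient lies in `(y)`. [folklore] -/
theorem mem_span_X_of_constantCoeff_eq_zero {M : ℕ} {w : MvPolynomial (Fin M) K} (hw : constantCoeff w = 0) :
    w ∈ Ideal.span (Set.range (X : Fin M → MvPolynomial (Fin M) K)) := by
  have h : w ∈ Ideal.span (Set.range (X : Fin M → MvPolynomial (Fin M) K)) ^ 1 := by
    refine (MvPolynomial.mem_pow_idealOfVars_iff' 1 w).mpr fun d hd => ?_
    have hd0 : d = 0 := by
      have : d.degree = 0 := by omega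
      exact (Finsupp.degree_eq_zero_iff d).mp this
    rw [hd0]
    exact hw
  rwa [pow_one] at h

/-- **Substituting polynomials without constant term preserves `(y)^k`.** [folklore] -/
theorem aeval_mem_pow_of_forall_mem {M M' : ℕ} (g : Fin M → MvPolynomial (Fin M') K)
    (hg : ∀ j, g j ∈ Ideal.span (Set.range (X : Fin M' → MvPolynomial (Fin M') K))) {Q : MvPolynomial (Fin M) K} {k : ℕ}
    (hQ : Q ∈ Ideal.span (Set.range (X : Fin M → MvPolynomial (Fin M) K)) ^ k) :
    aeval g Q ∈ Ideal.span (Set.range (X : Fin M' → MvPolynomial (Fin M') K)) ^ k := by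
  have h1 : Ideal.map (aeval g).toRingHom (Ideal.span (Set.range (X : Fin M → MvPolynomial (Fin M) K))) ≤
      Ideal.span (Set.range (X : Fin M' → MvPolynomial (Fin M') K)) := by
    rw [Ideal.map_span, Ideal.span_le]
    rintro _ ⟨_, ⟨j, rfl⟩, rfl⟩
    simp only [AlgHom.toRingHom_eq_coe, RingHom.coe_coe, aeval_X, SetLike.mem_coe]
    exact hg j
  have h2 := Ideal.mem_map_of_mem (aeval g).toRingHom hQ
  rw [Ideal.map_pow] at h2
  exact Ideal.pow_right_mono h1 k h2

/-! ## The initial form of the chart of `σ*P` -/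

/-- ★ **Initial form and remainder of the vertex chart of `σ*P`.**  `P` a form of degree `e` with `P(x_c := 1) = Φ + Ψ`, `Φ` a form of degree `μ ≤ e`,
`Ψ ∈ (y)^{μ+1}`; `σ` a substitution whose charts `ρ_i = σ_i(x_c := 1)` have no constant term for `i ≠ c`; `λ = ρ_c(0)`, `M_j = ρ_{c.succAbove j}`.  Then
`(σ*P)(x_c := 1) = λ^{e−μ}·Φ(M) + Ψ'` with `Ψ' ∈ (y)^{μ+1}`.  [cite: Hartshorne1977, I §2, proof of Prop. 2.2] [cite: Matsumura1987, §14] -/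
theorem dehomogenize_aeval_eq_initial_add {e : ℕ} {P : MvPolynomial (Fin (N + 1)) K} (hP : P.IsHomogeneous e)
    {Φ Ψ : MvPolynomial (Fin N) K} {μ : ℕ} (hΦ : Φ.IsHomogeneous μ)
    (hΨ : Ψ ∈ Ideal.span (Set.range (X : Fin N → MvPolynomial (Fin N) K)) ^ (μ + 1)) (hμe : μ ≤ e)
    (hdeh : ProjectiveSpace.dehomogenize K c P = Φ + Ψ)
    (σ : Fin (N + 1) → MvPolynomial (Fin (N + 1)) K)
    (hσ : ∀ i, i ≠ c → constantCoeff (ProjectiveSpace.dehomogenize K c (σ i)) = 0) :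
    ∃ Ψ' : MvPolynomial (Fin N) K, Ψ' ∈ Ideal.span (Set.range (X : Fin N → MvPolynomial (Fin N) K)) ^ (μ + 1) ∧
      ProjectiveSpace.dehomogenize K c (aeval σ P) =
        C (constantCoeff (ProjectiveSpace.dehomogenize K c (σ c)) ^ (e - μ)) *
          aeval (fun j => ProjectiveSpace.dehomogenize K c (σ (c.succAbove j))) Φ + Ψ' := by
  classical
  set I : Ideal (MvPolynomial (Fin N) K) := Ideal.span (Set.range (X : Fin N → MvPolynomial (Fin N) K)) with hI
  set ρc := ProjectiveSpace.dehomogenize K c (σ c) with hρc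
  set M : Fin N → MvPolynomial (Fin N) K := fun j => ProjectiveSpace.dehomogenize K c (σ (c.succAbove j)) with hM
  set lam := constantCoeff ρc with hlam
  have hMmem : ∀ j, M j ∈ I := fun j => mem_span_X_of_constantCoeff_eq_zero (hσ _ (Fin.succAbove_ne c j))
  obtain ⟨hQμ, hQlt⟩ := homogeneousComponent_add_of_mem_pow hΦ hΨ
  -- the terms of the expansion
  set T : ℕ → MvPolynomial (Fin N) K := fun m => ρc ^ (e - m) *
    aeval M (homogeneousComponent m (ProjectiveSpace.dehomogenize K c P)) with hT
  have hexp : ProjectiveSpace.dehomogenize K c (aeval σ P) = ∑ m ∈ Finset.range (e + 1), T m := dehomogenize_aeval_eq_sum c hP σ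
  have hμmem : μ ∈ Finset.range (e + 1) := Finset.mem_range.mpr (Nat.lt_succ_of_le hμe)
  rw [← Finset.add_sum_erase _ _ hμmem] at hexp
  -- the main term
  have hTμ : T μ = ρc ^ (e - μ) * aeval M Φ := by
    simp only [hT, hdeh, hQμ]
  -- `ρ_c^{e-μ} - λ^{e-μ} ∈ (y)`
  have hw : ρc - C lam ∈ I := by
    refine mem_span_X_of_constantCoeff_eq_zero ?_
    rw [map_sub, constantCoeff_C, hlam, sub_self]
  have hpow : ρc ^ (e - μ) - C (lam ^ (e - μ)) ∈ I := by
    obtain ⟨t, ht⟩ := sub_dvd_pow_sub_pow ρc (C lam) (e - μ)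
    rw [C_pow, ht]
    exact I.mul_mem_right t hw
  -- the other terms lie in `(y)^{μ+1}`
  have hrest : ∀ m ∈ (Finset.range (e + 1)).erase μ, T m ∈ I ^ (μ + 1) := by
    intro m hm
    have hne : m ≠ μ := Finset.ne_of_mem_erase hm
    rcases Nat.lt_or_gt_of_ne hne with hlt | hgt
    · have h0 : homogeneousComponent m (ProjectiveSpace.dehomogenize K c P) = 0 := by rw [hdeh]; exact hQlt m hlt
      simp only [hT, h0, map_zero, mul_zero]
      exact zero_mem _
    · have hmem : aeval M (homogeneousComponent m (ProjectiveSpace.dehomogenize K c P)) ∈ I ^ (μ + 1) :=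
        Ideal.pow_le_pow_right hgt (aeval_mem_pow_of_forall_mem M hMmem (mem_pow_of_isHomogeneous (homogeneousComponent_isHomogeneous m _)))
      exact (I ^ (μ + 1)).mul_mem_left _ hmem
  refine ⟨(ρc ^ (e - μ) - C (lam ^ (e - μ))) * aeval M Φ + ∑ m ∈ (Finset.range (e + 1)).erase μ, T m, ?_, ?_⟩
  · refine (I ^ (μ + 1)).add_mem ?_ (Ideal.sum_mem _ hrest)
    have h := Ideal.mul_mem_mul hpow (aeval_mem_pow_of_forall_mem M hMmem (mem_pow_of_isHomogeneous hΦ))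
    rwa [← pow_succ'] at h
  · rw [hexp, hTμ]
    ring

end MultiOrd

end Summit.ResolutionOfSingularities.ResolutionOfSingularities.Cruxes.EquisingularLiftNat.Sections

end
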